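import Summits.NavierStokesRegularity.NavierStokesRegularity.Theses.StretchingWellBinding
import Literature.Analysis.FluidPDE.LocalTypeILiouville

/-!
# Birth skeleton (BC3) for the crux `StretchingWellBinding.NoLocalTypeISingularity` (stmt-NavierStokesRegularity-10480)

Crux (route `route-NavierStokesRegularity-StretchingWellBinding`, rank 3, FIXED):
`NoLocalTypeISingularity := ¬ ∃ r₀ z u p, Literature.Analysis.FluidPDE.IsLocalTypeISingularPoint r₀ z u p`
— no suitable weak solution of the unforced unit-viscosity Navier–Stokes system in a parabolic
ball has its centre as a backward singular point with Albritton–Barker's Type-I quantity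
`𝐈(Q(z,r₀)) = sup_{Q' ⊆ Q(z,r₀)} (A+C+D+E)(Q') < ∞` (Albritton–Barker 2019 = arXiv:1811.00502,
Thm 1.1, first bullet, NEGATED; `Iff.rfl`-equal to `¬ Literature.Analysis.FluidPDE.LocalTypeISingularityExists`).

Line `birth` = the route header's own foreseen layer-2 split of crux #3 (TWO-LAYER PLAN:
"#3 ⇐ AB-forward ∧ (L')"), i.e. ZOOM IN, THEN LIOUVILLE, typed over existing declarations:

* `stub_typeIZoom` (Albritton–Barker 2019 Thm 1.1, forward direction = Prop. 2.4 + the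
  Seregin–Šverák 2009 Thm 2.8 rescaling at an earliest singular point; a published theorem, size
  L–XL to formalise; NOT in tree — the tree vendors it as the named fact
  `Literature.Analysis.FluidPDE.AlbrittonBarkerForward` and proves only the reverse direction,
  `localTypeISingularityExists_of_nontrivialMildAncientTypeIExists` /
  `localTypeISingularityExists_of_suitable_nontrivial'`): a local Type-I singular point yields a
  Type-I BLOW-UP PROFILE — a bounded ancient mild solution `v` (`ν = 1`, duality-form class
  `IsBoundedAncientMildSolution`) with a pressure `q` making `(v,q)` suitable weak on the slab
  `(-∞,0) × ℝ³`, a weak spatial gradient `G`, `v` not a.e. zero, `𝐈(ℝ³ × ℝ₋) < ∞`, and — the one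
  clause added to the body of `AlbrittonBarkerForward` — a.e.-strongly measurable slices `v t` at
  EVERY `t < 0` (true of the printed construction: the Seregin–Šverák limit is a mild bounded
  ancient solution in KNSS's sense, smooth on `ℝ³ × (-∞,0)` by KNSS 2009 §4; the clause closes the
  slice-measurability gap between the duality-form class and (L) recorded by grounder g27-25 and in
  `LocalTypeILiouville.lean`).
* `stub_typeILiouville` ((L_I) = the KNSS Liouville conjecture (L) RESTRICTED to Albritton–Barker's
  Type-I class; OPEN, load-bearing): a bounded ancient mild solution with measurable slices, suitable
  weak on the slab with pressure `q` and weak gradient `G`, and `𝐈(ℝ³ × ℝ₋) < ∞`, is spatially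
  constant on every slice. It is VERBATIM implied by (L) (`Summit.…​.LiouvilleConjectureNS` =
  item `TypeILiouville.TypeIliouvilleL`, stmt-NavierStokesRegularity-10661: drop three hypotheses), so
  a proof of that shared item closes this stub in one line; it is strictly weaker than (L) (steady and
  travelling-wave bounded solutions have `𝐈 = ∞` unless zero and are not in its scope). Known cases:
  axisymmetric (KNSS 2009 Thms 5.2–5.3 with Seregin–Šverák 2009), backward self-similar profiles
  (Nečas–Růžička–Šverák 1996, Tsai 1998), λ-DSS with λ near 1 (Chae–Wolf 2017).
* `NoLocalTypeISingularity_of : Sig.stub_typeIZoom → Sig.stub_typeILiouville → NoLocalTypeISingularity`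
  (the `Sig.stub_*` are the two stub signatures as named `Prop`s, so that the composition's hypotheses are the
  declared stubs BY NAME, as `#h21_check_skeleton` requires; kernel-checked, no sorry of its own): a hypothetical Type-I singular point is zoomed into a
  profile `(v,q,G)`; (L_I) makes a.e. every slice of `v` a.e. constant; the PROVED tree lemma
  `Literature.Analysis.FluidPDE.not_ae_slice_const_of_abTypeIBound` (Albritton–Barker §1: "`v ≡`
  const. and `𝐈 < ∞` imply `v ≡ 0`"; joint measurability from the weak gradient) contradicts
  non-triviality. The final `example` instantiates the composition with the two stubs (kernel check
  that the composition's hypotheses are literally the stub signatures and its conclusion literally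
  the route decl).

Why the transfer is a genuine reduction and not a costume: the profile side replaces ONE singular
suitable weak solution in ONE ball (no structure beyond the local energy inequality) by a GLOBAL,
bounded, smooth ancient solution carrying the scale-invariant bound at all scales and centres — the
setting where maximum principles (KNSS Thms 5.1–5.3), backward uniqueness / unique continuation
(Escauriaza–Seregin–Šverák) and DSS/self-similar rigidity (Tsai, Chae–Wolf) act; every known case of
the crux was proved on that side.

Disproof used: none relevant — the crux directory `Cruxes/NoLocalTypeISingularity/` had no
`Disproof.lean`, no Ideas and no Lines when this skeleton was registered (2026-08-17); the refuter
evidence on the item (RefuterEvidence10480: `crux_iff`, `crux_iff_not_ancient`, `crux_of_liouville`,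
junk-model exclusions) is honoured: the line IS `crux_of_liouville`'s shape with (L) weakened to (L_I)
and the measurable-slice proviso carried by the zoom stub.

BC3 probes (planner folder `bc/probe_*.lean`, each importing this file's imports but NOT this file):
for each stub `S`, `example : S → NoLocalTypeISingularity` and `example : S → NavierStokesRegularity`
by `first | exact? | simpa […] | (unfold …; simpa) | aesop` — all four FAIL (see NOTES.md of the
registering seat for the raw diagnostics).
-/

namespace Summit.NavierStokesRegularity.NavierStokesRegularity.Cruxes.NoLocalTypeISingularity.Birth

open MeasureTheory Set Function Filter
open scoped ENNReal NNReal Topology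

/-! ### The two stub statements as named propositions

The skeleton audit (`#h21_check_skeleton`) requires the composition's hypotheses to be declared stubs BY NAME:
`Sig.stub_X` is the statement of `stub_X` (same text; the final `example` kernel-checks the agreement). -/

/-- Statement of stub 1 (`stub_typeIZoom`): Albritton–Barker 2019 Thm 1.1, forward direction, with measurable
slices of the profile (see the stub's docstring). -/
def Sig.stub_typeIZoom : Prop :=
    ∀ (r₀ : ℝ) (z : ℝ × EuclideanSpace ℝ (Fin 3))
      (u : ℝ → EuclideanSpace ℝ (Fin 3) → EuclideanSpace ℝ (Fin 3))
      (p : ℝ → EuclideanSpace ℝ (Fin 3) → ℝ),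
      Literature.Analysis.FluidPDE.IsLocalTypeISingularPoint r₀ z u p →
      ∃ (v : ℝ → EuclideanSpace ℝ (Fin 3) → EuclideanSpace ℝ (Fin 3))
        (q : ℝ → EuclideanSpace ℝ (Fin 3) → ℝ)
        (G : ℝ → EuclideanSpace ℝ (Fin 3) → EuclideanSpace ℝ (Fin 3) →L[ℝ] EuclideanSpace ℝ (Fin 3)),
        (∀ t < 0, AEStronglyMeasurable (v t) volume) ∧
        Literature.Analysis.FluidPDE.IsBoundedAncientMildSolution 1 v ∧
        Literature.Analysis.FluidPDE.IsSuitableWeakSolutionOn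
          (Literature.Analysis.FluidPDE.slab (EuclideanSpace ℝ (Fin 3)) (Iio 0) isOpen_Iio) 1 0 v q ∧
        Literature.Analysis.FluidPDE.HasWeakSpatialGradientOn
          (Literature.Analysis.FluidPDE.slab (EuclideanSpace ℝ (Fin 3)) (Iio 0) isOpen_Iio) v G ∧
        ¬ (uncurry v =ᵐ[volume.restrict (Iio (0 : ℝ) ×ˢ (univ : Set (EuclideanSpace ℝ (Fin 3))))] 0) ∧
        Literature.Analysis.FluidPDE.typeIBound
          (Iio (0 : ℝ) ×ˢ (univ : Set (EuclideanSpace ℝ (Fin 3)))) v q G < ⊤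

/-- Statement of stub 2 (`stub_typeILiouville`): the KNSS Liouville conjecture restricted to Albritton–Barker's
Type-I class, (L_I) (see the stub's docstring). -/
def Sig.stub_typeILiouville : Prop :=
    ∀ (v : ℝ → EuclideanSpace ℝ (Fin 3) → EuclideanSpace ℝ (Fin 3))
      (q : ℝ → EuclideanSpace ℝ (Fin 3) → ℝ)
      (G : ℝ → EuclideanSpace ℝ (Fin 3) → EuclideanSpace ℝ (Fin 3) →L[ℝ] EuclideanSpace ℝ (Fin 3)),
      (∀ t < 0, AEStronglyMeasurable (v t) volume) →
      Literature.Analysis.FluidPDE.IsBoundedAncientMildSolution 1 v →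
      Literature.Analysis.FluidPDE.IsSuitableWeakSolutionOn
        (Literature.Analysis.FluidPDE.slab (EuclideanSpace ℝ (Fin 3)) (Iio 0) isOpen_Iio) 1 0 v q →
      Literature.Analysis.FluidPDE.HasWeakSpatialGradientOn
        (Literature.Analysis.FluidPDE.slab (EuclideanSpace ℝ (Fin 3)) (Iio 0) isOpen_Iio) v G →
      Literature.Analysis.FluidPDE.typeIBound
        (Iio (0 : ℝ) ×ˢ (univ : Set (EuclideanSpace ℝ (Fin 3)))) v q G < ⊤ →
      ∀ t < 0, ∃ b : EuclideanSpace ℝ (Fin 3), v t =ᵐ[volume] fun _ => b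

/-! ### The stubs (the ONLY sorries of this file) -/

/-- **Stub 1 (TypeIZoom; Albritton–Barker 2019 Thm 1.1 ⇒, with measurable slices).** If `(u, p)`
is a suitable weak solution (`ν = 1`, `f = 0`) in a parabolic ball `Q(z, r₀)` whose centre is a
backward singular point with `𝐈(Q(z, r₀)) < ∞` (`IsLocalTypeISingularPoint r₀ z u p`), then there is
a triple `(v, q, G)`: `v` a bounded ancient mild solution on `ℝ³ × (-∞, 0)` with a.e.-strongly
measurable slices `v t` (`t < 0`), `(v, q)` suitable weak on the slab `(-∞, 0) × ℝ³`, `G` a weak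
spatial gradient of `v` there, `v` not a.e. zero on the slab, and
`𝐈 = typeIBound ((-∞,0) × ℝ³) v q G < ∞`. Printed proof (arXiv:1811.00502 §3): move to an earliest
singular point `z*` in `Q(z, r₀)` (Prop. 2.4, regular-cylinder lemma of Kukavica–Rusin–Ziane), rescale
around near-maximum points `z_k → z*` (Seregin–Šverák 2009 = arXiv:0804.1803, Thm 2.8) — the limit is
a non-trivial mild bounded ancient solution (smooth, KNSS 2009 §4, hence measurable slices), and
`𝐈 < ∞` is inherited from the balls around the `z_k` by scale invariance of `A, C, D, E`. Tree tools:
`SuitableCompactness_holds` (Lemma 2.2), `PersistenceOfSingularities_holds` (Prop. 2.3), CKN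
ε-regularity, `KNSS2009_blowup_generates_ancient_holds` (the `L^∞` zoom). Why it might fail as typed:
only through a mismatch between the tree's duality-form class `IsBoundedAncientMildSolution` /
`IsSuitableWeakSolutionOn` and the printed classes (the printed statement is a theorem). -/
theorem stub_typeIZoom :
    ∀ (r₀ : ℝ) (z : ℝ × EuclideanSpace ℝ (Fin 3))
      (u : ℝ → EuclideanSpace ℝ (Fin 3) → EuclideanSpace ℝ (Fin 3))
      (p : ℝ → EuclideanSpace ℝ (Fin 3) → ℝ),
      Literature.Analysis.FluidPDE.IsLocalTypeISingularPoint r₀ z u p →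
      ∃ (v : ℝ → EuclideanSpace ℝ (Fin 3) → EuclideanSpace ℝ (Fin 3))
        (q : ℝ → EuclideanSpace ℝ (Fin 3) → ℝ)
        (G : ℝ → EuclideanSpace ℝ (Fin 3) → EuclideanSpace ℝ (Fin 3) →L[ℝ] EuclideanSpace ℝ (Fin 3)),
        (∀ t < 0, AEStronglyMeasurable (v t) volume) ∧
        Literature.Analysis.FluidPDE.IsBoundedAncientMildSolution 1 v ∧
        Literature.Analysis.FluidPDE.IsSuitableWeakSolutionOn
          (Literature.Analysis.FluidPDE.slab (EuclideanSpace ℝ (Fin 3)) (Iio 0) isOpen_Iio) 1 0 v q ∧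
        Literature.Analysis.FluidPDE.HasWeakSpatialGradientOn
          (Literature.Analysis.FluidPDE.slab (EuclideanSpace ℝ (Fin 3)) (Iio 0) isOpen_Iio) v G ∧
        ¬ (uncurry v =ᵐ[volume.restrict (Iio (0 : ℝ) ×ˢ (univ : Set (EuclideanSpace ℝ (Fin 3))))] 0) ∧
        Literature.Analysis.FluidPDE.typeIBound
          (Iio (0 : ℝ) ×ˢ (univ : Set (EuclideanSpace ℝ (Fin 3)))) v q G < ⊤ := by
  sorry

/-- **Stub 2 (TypeILiouville = (L_I), the Liouville conjecture for Type-I profiles; OPEN,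
load-bearing).** Every bounded ancient mild solution `v` of Navier–Stokes (`ν = 1`) on
`ℝ³ × (-∞, 0)` with a.e.-strongly measurable slices, which together with a pressure `q` is a
suitable weak solution on the slab, has a weak spatial gradient `G` there, and satisfies
Albritton–Barker's Type-I bound `𝐈 = typeIBound ((-∞,0) × ℝ³) v q G < ∞`, is spatially constant on
every slice: `v t = b` a.e. for each `t < 0` (whence `v = 0` a.e., since constants have `𝐈 = ∞`
unless zero — `not_ae_slice_const_of_abTypeIBound`). This is conjecture (L) of
Koch–Nadirashvili–Seregin–Šverák 2009 (arXiv:0709.3599 §1; in tree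
`Summit.NavierStokesRegularity.NavierStokesRegularity.LiouvilleConjectureNS`, item
`TypeILiouville.TypeIliouvilleL` = stmt-NavierStokesRegularity-10661) restricted to the Type-I
class, = Albritton–Barker's (L') ("no non-trivial mild bounded ancient solution with `𝐈 < ∞`",
arXiv:1811.00502 Thm 1.1 second bullet negated) up to the measurability proviso; (L) implies it
verbatim. Known cases: axisymmetric with or without swirl under the Type-I bound (KNSS 2009
Thms 5.2–5.3 = `knss_axisymmetric_no_swirl`, `knss_bound_C_over_r`; Seregin–Šverák 2009), backward
self-similar (Nečas–Růžička–Šverák 1996, Tsai 1998), λ-DSS for λ close to 1 (Chae–Wolf 2017,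
arXiv:1610.09464). Why it might fail: one Type-I blow-up profile — e.g. a backward discretely
self-similar solution with a non-trivial profile, sought by the Blowup / DssFarFieldSlaving routes —
refutes it (and the crux with it, by the PROVED reverse direction). -/
theorem stub_typeILiouville :
    ∀ (v : ℝ → EuclideanSpace ℝ (Fin 3) → EuclideanSpace ℝ (Fin 3))
      (q : ℝ → EuclideanSpace ℝ (Fin 3) → ℝ)
      (G : ℝ → EuclideanSpace ℝ (Fin 3) → EuclideanSpace ℝ (Fin 3) →L[ℝ] EuclideanSpace ℝ (Fin 3)),
      (∀ t < 0, AEStronglyMeasurable (v t) volume) →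
      Literature.Analysis.FluidPDE.IsBoundedAncientMildSolution 1 v →
      Literature.Analysis.FluidPDE.IsSuitableWeakSolutionOn
        (Literature.Analysis.FluidPDE.slab (EuclideanSpace ℝ (Fin 3)) (Iio 0) isOpen_Iio) 1 0 v q →
      Literature.Analysis.FluidPDE.HasWeakSpatialGradientOn
        (Literature.Analysis.FluidPDE.slab (EuclideanSpace ℝ (Fin 3)) (Iio 0) isOpen_Iio) v G →
      Literature.Analysis.FluidPDE.typeIBound
        (Iio (0 : ℝ) ×ˢ (univ : Set (EuclideanSpace ℝ (Fin 3)))) v q G < ⊤ →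
      ∀ t < 0, ∃ b : EuclideanSpace ℝ (Fin 3), v t =ᵐ[volume] fun _ => b := by
  sorry

/-! ### Composition -/

/-- **Composition (kernel-checked, no sorry of its own).** The two stub statements imply the crux
`StretchingWellBinding.NoLocalTypeISingularity` BY NAME: unpack a hypothetical local Type-I singular
point `(r₀, z, u, p)`, zoom into a Type-I profile `(v, q, G)` (stub 1), make a.e. every slice of `v`
a.e. constant (stub 2, at every `t < 0`, transported along `ae_restrict_mem`), and contradict
`Literature.Analysis.FluidPDE.not_ae_slice_const_of_abTypeIBound` (proved in tree; the joint
a.e.-strong measurability of `v` on the slab comes from the weak spatial gradient). -/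
theorem NoLocalTypeISingularity_of :
    Sig.stub_typeIZoom → Sig.stub_typeILiouville →
    Summit.NavierStokesRegularity.NavierStokesRegularity.Theses.StretchingWellBinding.NoLocalTypeISingularity := by
  intro hZoom hLiou
  unfold Sig.stub_typeIZoom at hZoom
  unfold Sig.stub_typeILiouville at hLiou
  rintro ⟨r₀, z, u, p, hTI⟩
  obtain ⟨v, q, G, hmeas, hv, hsw, hG, hne, hI⟩ := hZoom r₀ z u p hTI
  have hconst : ∀ᵐ t ∂(volume.restrict (Iio (0 : ℝ))),
      ∃ b : EuclideanSpace ℝ (Fin 3), v t =ᵐ[volume] fun _ => b := by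
    filter_upwards [ae_restrict_mem measurableSet_Iio] with t ht
    exact hLiou v q G hmeas hv hsw hG hI t ht
  exact Literature.Analysis.FluidPDE.not_ae_slice_const_of_abTypeIBound
    hG.locallyIntegrableOn.aestronglyMeasurable hne hI hconst

/-- Kernel check (anonymous, adds no declaration): the composition instantiated with the two stubs
has type the crux BY NAME — so the composition's hypotheses are literally the stub signatures. -/
example :
    Summit.NavierStokesRegularity.NavierStokesRegularity.Theses.StretchingWellBinding.NoLocalTypeISingularity :=
  NoLocalTypeISingularity_of stub_typeIZoom stub_typeILiouville

end Summit.NavierStokesRegularity.NavierStokesRegularity.Cruxes.NoLocalTypeISingularity.Birth
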